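import Mathlib

/-!
# Kernel Harris–Kleitman chain and kernel antipodal strong Harris for monotone labellings

Helper file for crux `stmt-CriticalPhenomena-4575` (`NoHeavyLowerTail`, route `PercNearOneGluingNoHeavy`), hull-port seat `prim-hp-7`
(generation 62); `--supports stmt-CriticalPhenomena-4575`.  Everything here is PROVED; no definitions, no `sorry`, no named facts.

**Setting.**  `Φ, Ψ : Finset α → β` are labellings of the finite subsets of `α` by a preordered type `β`, monotone
(`X ⊆ Y → Φ X ≤ Φ Y`); `κ : β → β → ℤ` is a kernel; `S : Finset α` is the ground set.  Three sums over the cube `2^S` occur: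
the ANTIPODAL sum `A_S(κ;Φ,Ψ) = Σ_{X ⊆ S} κ(Φ X, Ψ(S ∖ X))`, the DIAGONAL sum `D_S(κ;Φ,Ψ) = Σ_{X ⊆ S} κ(Φ X, Ψ X)` and the
bilinear POTENTIAL `Q_S(κ;Φ,Ψ) = Σ_{X ⊆ S} Σ_{Y ⊆ S} κ(Φ X, Ψ Y)` (all written out in the statements).

**Theorem 1 (kernel Harris–Kleitman chain: `two_pow_mul_antipodal_le_potential`, `potential_le_two_pow_mul_diagonal`,
`antipodal_le_diagonal`).**  If `κ` is 2-increasing (`x ≤ y, x' ≤ y' ⟹ κ x y' + κ y x' ≤ κ y y' + κ x x'`), then for all monotone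
`Φ, Ψ`:  `2^{#S} · A_S(κ;Φ,Ψ) ≤ Q_S(κ;Φ,Ψ) ≤ 2^{#S} · D_S(κ;Φ,Ψ)`, in particular `Σ_X κ(Φ X, Ψ(S∖X)) ≤ Σ_X κ(Φ X, Ψ X)`.
For indicator kernels of two up-sets this is Kleitman's lemma followed by Harris' inequality,
`2^n #(𝒳 ∩ 𝒴*) ≤ #𝒳 · #𝒴 ≤ 2^n #(𝒳 ∩ 𝒴)` (`𝒴*` the complement-reflection of `𝒴`), as used in
`OrientedAntipodalHall.card_straddle_pairs_le_card_goods`; the uniform-measure 'mean-field' half `Q ≤ 2^n D` for general kernels is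
the finite form of N. Gladkov's Harris–Kleitman type inequality for 2-increasing kernels (draft *On Harris–Kleitman type inequalities*,
2024, Thm 2.1/2.3); the antipodal half and the chain are recorded by this seat (prim-hp-7 g62, 2026-08-23).  Proof: splitting off one
coordinate, both steps reduce to the 2-increasing inequality applied termwise inside the double sum.

**Theorem 2 (kernel antipodal strong Harris, `antipodal_nonneg_of_submodular`).**  If `κ` is 2-decreasing (submodular on rectangles of
comparable pairs) and `0 ≤ κ x y` whenever `x ≤ y`, then `0 ≤ A_S(κ;Φ,Ψ)` for all monotone `Φ ≤ Ψ` (pointwise): the kernel form of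
`AntipodalStrongHarris.antipodalSum_nonneg` (prim-ineq-gen-1), same induction.

These are the two 'cones' of valid linear inequalities for antipodal pair-profiles of monotone labellings used as level-1 rows in the
certificate search for hp-7's Conjecture K / K♯ (memo `prim-hp-7/FROM-prim-hp-7-g62-KSHARP-CONES.md`); recorded here as reusable tools.
-/

namespace Summit.CriticalPhenomena.PercolationContinuityZ3.Theorems

namespace KernelKleitman

open Finset

variable {α : Type*} [DecidableEq α] {β : Type*}

/-- For `X ⊆ S` with `a ∉ S`: `(S ∪ {a}) ∖ X = (S ∖ X) ∪ {a}`. -/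
theorem insert_sdiff_eq_insert_sdiff {S X : Finset α} {a : α} (hX : X ⊆ S) (ha : a ∉ S) :
    insert a S \ X = insert a (S \ X) :=
  insert_sdiff_of_notMem S fun h => ha (hX h)

/-- For `a ∉ S`: `(S ∪ {a}) ∖ (X ∪ {a}) = S ∖ X`. -/
theorem insert_sdiff_insert_eq {S X : Finset α} {a : α} (ha : a ∉ S) :
    insert a S \ insert a X = S \ X := by
  ext x
  simp only [mem_sdiff, mem_insert]
  constructor
  · rintro ⟨h1 | h1, h2⟩
    · exact (h2 (Or.inl h1)).elim
    · exact ⟨h1, fun hx => h2 (Or.inr hx)⟩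
  · rintro ⟨h1, h2⟩
    refine ⟨Or.inr h1, ?_⟩
    rintro (rfl | hx)
    · exact ha h1
    · exact h2 hx

/-- Splitting off one coordinate in the antipodal sum:
`A_{S∪{a}}(κ;Φ,Ψ) = A_S(κ;Φ, Ψ(·∪{a})) + A_S(κ;Φ(·∪{a}), Ψ)`. -/
theorem antipodal_insert {S : Finset α} {a : α} (ha : a ∉ S) (κ : β → β → ℤ) (Φ Ψ : Finset α → β) :
    ∑ X ∈ (insert a S).powerset, κ (Φ X) (Ψ (insert a S \ X)) =
      ∑ X ∈ S.powerset, κ (Φ X) (Ψ (insert a (S \ X))) +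
        ∑ X ∈ S.powerset, κ (Φ (insert a X)) (Ψ (S \ X)) := by
  rw [sum_powerset_insert ha]
  congr 1
  · exact sum_congr rfl fun X hX => by rw [insert_sdiff_eq_insert_sdiff (mem_powerset.mp hX) ha]
  · exact sum_congr rfl fun X hX => by rw [insert_sdiff_insert_eq ha]

/-- Splitting off one coordinate in the potential (four blocks):
`Q_{S∪{a}}(Φ,Ψ) = Q_S(Φ,Ψ) + Q_S(Φ,Ψ₁) + (Q_S(Φ₁,Ψ) + Q_S(Φ₁,Ψ₁))`, `Φ₁ = Φ(·∪{a})`, `Ψ₁ = Ψ(·∪{a})`. -/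
theorem potential_insert {S : Finset α} {a : α} (ha : a ∉ S) (κ : β → β → ℤ) (Φ Ψ : Finset α → β) :
    ∑ X ∈ (insert a S).powerset, ∑ Y ∈ (insert a S).powerset, κ (Φ X) (Ψ Y) =
      ∑ X ∈ S.powerset, ∑ Y ∈ S.powerset, κ (Φ X) (Ψ Y) +
        ∑ X ∈ S.powerset, ∑ Y ∈ S.powerset, κ (Φ X) (Ψ (insert a Y)) +
        (∑ X ∈ S.powerset, ∑ Y ∈ S.powerset, κ (Φ (insert a X)) (Ψ Y) +
          ∑ X ∈ S.powerset, ∑ Y ∈ S.powerset, κ (Φ (insert a X)) (Ψ (insert a Y))) := by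
  rw [sum_powerset_insert ha]
  congr 1
  · rw [← sum_add_distrib]
    exact sum_congr rfl fun X _ => by rw [sum_powerset_insert ha]
  · rw [← sum_add_distrib]
    exact sum_congr rfl fun X _ => by rw [sum_powerset_insert ha]

section Chain

variable [Preorder β]

/-- The termwise step: for monotone `Φ, Ψ` and 2-increasing `κ`, the two 'cross' blocks of the potential are dominated by the two
'level' blocks: `Q_S(Φ,Ψ₁) + Q_S(Φ₁,Ψ) ≤ Q_S(Φ,Ψ) + Q_S(Φ₁,Ψ₁)`. -/
theorem potential_cross_le {κ : β → β → ℤ}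
    (hκ : ∀ ⦃x y x' y' : β⦄, x ≤ y → x' ≤ y' → κ x y' + κ y x' ≤ κ y y' + κ x x')
    (S : Finset α) (a : α) {Φ Ψ : Finset α → β}
    (hΦ : ∀ ⦃X Y : Finset α⦄, X ⊆ Y → Φ X ≤ Φ Y) (hΨ : ∀ ⦃X Y : Finset α⦄, X ⊆ Y → Ψ X ≤ Ψ Y) :
    ∑ X ∈ S.powerset, ∑ Y ∈ S.powerset, κ (Φ X) (Ψ (insert a Y)) +
        ∑ X ∈ S.powerset, ∑ Y ∈ S.powerset, κ (Φ (insert a X)) (Ψ Y) ≤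
      ∑ X ∈ S.powerset, ∑ Y ∈ S.powerset, κ (Φ X) (Ψ Y) +
        ∑ X ∈ S.powerset, ∑ Y ∈ S.powerset, κ (Φ (insert a X)) (Ψ (insert a Y)) := by
  rw [← sum_add_distrib, ← sum_add_distrib]
  refine sum_le_sum fun X _ => ?_
  rw [← sum_add_distrib, ← sum_add_distrib]
  refine sum_le_sum fun Y _ => ?_
  have h := hκ (hΦ (subset_insert a X)) (hΨ (subset_insert a Y))
  linarith

/-- **Kernel Kleitman lemma (antipodal half of the chain).**  For a 2-increasing kernel `κ` and monotone labellings `Φ, Ψ`: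
`2^{#S} · Σ_{X ⊆ S} κ(Φ X, Ψ(S∖X)) ≤ Σ_{X,Y ⊆ S} κ(Φ X, Ψ Y)`. -/
theorem two_pow_mul_antipodal_le_potential {κ : β → β → ℤ}
    (hκ : ∀ ⦃x y x' y' : β⦄, x ≤ y → x' ≤ y' → κ x y' + κ y x' ≤ κ y y' + κ x x') (S : Finset α) :
    ∀ Φ Ψ : Finset α → β, (∀ ⦃X Y : Finset α⦄, X ⊆ Y → Φ X ≤ Φ Y) → (∀ ⦃X Y : Finset α⦄, X ⊆ Y → Ψ X ≤ Ψ Y) →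
      2 ^ S.card * ∑ X ∈ S.powerset, κ (Φ X) (Ψ (S \ X)) ≤
        ∑ X ∈ S.powerset, ∑ Y ∈ S.powerset, κ (Φ X) (Ψ Y) := by
  induction S using Finset.induction_on with
  | empty =>
    intro Φ Ψ _ _
    simp
  | insert a S ha ih =>
    intro Φ Ψ hΦ hΨ
    rw [antipodal_insert ha, potential_insert ha, card_insert_of_notMem ha, pow_succ]
    have hΦ₁ : ∀ ⦃X Y : Finset α⦄, X ⊆ Y → Φ (insert a X) ≤ Φ (insert a Y) :=
      fun _ _ hXY => hΦ (insert_subset_insert a hXY)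
    have hΨ₁ : ∀ ⦃X Y : Finset α⦄, X ⊆ Y → Ψ (insert a X) ≤ Ψ (insert a Y) :=
      fun _ _ hXY => hΨ (insert_subset_insert a hXY)
    have h01 := ih Φ (fun X => Ψ (insert a X)) hΦ hΨ₁
    have h10 := ih (fun X => Φ (insert a X)) Ψ hΦ₁ hΨ
    have hx := potential_cross_le hκ S a hΦ hΨ
    nlinarith [h01, h10, hx]

/-- **Kernel Harris inequality (mean-field half of the chain).**  For a 2-increasing kernel `κ` and monotone `Φ, Ψ`:
`Σ_{X,Y ⊆ S} κ(Φ X, Ψ Y) ≤ 2^{#S} · Σ_{X ⊆ S} κ(Φ X, Ψ X)` (uniform-measure case of Gladkov's Harris–Kleitman type inequality). -/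
theorem potential_le_two_pow_mul_diagonal {κ : β → β → ℤ}
    (hκ : ∀ ⦃x y x' y' : β⦄, x ≤ y → x' ≤ y' → κ x y' + κ y x' ≤ κ y y' + κ x x') (S : Finset α) :
    ∀ Φ Ψ : Finset α → β, (∀ ⦃X Y : Finset α⦄, X ⊆ Y → Φ X ≤ Φ Y) → (∀ ⦃X Y : Finset α⦄, X ⊆ Y → Ψ X ≤ Ψ Y) →
      ∑ X ∈ S.powerset, ∑ Y ∈ S.powerset, κ (Φ X) (Ψ Y) ≤
        2 ^ S.card * ∑ X ∈ S.powerset, κ (Φ X) (Ψ X) := by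
  induction S using Finset.induction_on with
  | empty =>
    intro Φ Ψ _ _
    simp
  | insert a S ha ih =>
    intro Φ Ψ hΦ hΨ
    rw [potential_insert ha, sum_powerset_insert ha, card_insert_of_notMem ha, pow_succ]
    have hΦ₁ : ∀ ⦃X Y : Finset α⦄, X ⊆ Y → Φ (insert a X) ≤ Φ (insert a Y) :=
      fun _ _ hXY => hΦ (insert_subset_insert a hXY)
    have hΨ₁ : ∀ ⦃X Y : Finset α⦄, X ⊆ Y → Ψ (insert a X) ≤ Ψ (insert a Y) :=
      fun _ _ hXY => hΨ (insert_subset_insert a hXY)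
    have h00 := ih Φ Ψ hΦ hΨ
    have h11 := ih (fun X => Φ (insert a X)) (fun X => Ψ (insert a X)) hΦ₁ hΨ₁
    have hx := potential_cross_le hκ S a hΦ hΨ
    nlinarith [h00, h11, hx]

/-- **Kernel Harris–Kleitman chain.**  For a 2-increasing kernel `κ` and monotone labellings `Φ, Ψ` of the subsets of `S`,
the antipodal kernel sum is at most the diagonal one:  `Σ_{X ⊆ S} κ(Φ X, Ψ(S ∖ X)) ≤ Σ_{X ⊆ S} κ(Φ X, Ψ X)`. -/
theorem antipodal_le_diagonal {κ : β → β → ℤ}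
    (hκ : ∀ ⦃x y x' y' : β⦄, x ≤ y → x' ≤ y' → κ x y' + κ y x' ≤ κ y y' + κ x x') (S : Finset α)
    {Φ Ψ : Finset α → β}
    (hΦ : ∀ ⦃X Y : Finset α⦄, X ⊆ Y → Φ X ≤ Φ Y) (hΨ : ∀ ⦃X Y : Finset α⦄, X ⊆ Y → Ψ X ≤ Ψ Y) :
    ∑ X ∈ S.powerset, κ (Φ X) (Ψ (S \ X)) ≤ ∑ X ∈ S.powerset, κ (Φ X) (Ψ X) := by
  have h1 := two_pow_mul_antipodal_le_potential hκ S Φ Ψ hΦ hΨ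
  have h2 := potential_le_two_pow_mul_diagonal hκ S Φ Ψ hΦ hΨ
  have hpow : (0 : ℤ) < 2 ^ S.card := by positivity
  exact le_of_mul_le_mul_left (h1.trans h2) hpow

end Chain

section StrongHarris

variable [Preorder β]

/-- **Kernel antipodal strong Harris inequality.**  If `κ` is 2-decreasing (`x ≤ y, x' ≤ y' ⟹ κ y y' + κ x x' ≤ κ x y' + κ y x'`)
and nonnegative on comparable pairs (`x ≤ y → 0 ≤ κ x y`), then for monotone labellings `Φ ≤ Ψ` (pointwise)
`0 ≤ Σ_{X ⊆ S} κ(Φ X, Ψ(S∖X))`.  Kernel form of `AntipodalStrongHarris.antipodalSum_nonneg`: split off a coordinate,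
`A(Φ,Ψ₁) + A(Φ₁,Ψ) ≥ A(Φ,Ψ) + A(Φ₁,Ψ₁)` termwise by submodularity, and induct. -/
theorem antipodal_nonneg_of_submodular {κ : β → β → ℤ}
    (hκ : ∀ ⦃x y x' y' : β⦄, x ≤ y → x' ≤ y' → κ y y' + κ x x' ≤ κ x y' + κ y x')
    (hκ0 : ∀ ⦃x y : β⦄, x ≤ y → 0 ≤ κ x y) (S : Finset α) :
    ∀ Φ Ψ : Finset α → β, (∀ ⦃X Y : Finset α⦄, X ⊆ Y → Φ X ≤ Φ Y) → (∀ ⦃X Y : Finset α⦄, X ⊆ Y → Ψ X ≤ Ψ Y) →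
      (∀ X, Φ X ≤ Ψ X) → 0 ≤ ∑ X ∈ S.powerset, κ (Φ X) (Ψ (S \ X)) := by
  induction S using Finset.induction_on with
  | empty =>
    intro Φ Ψ _ _ hle
    simp only [powerset_empty, sum_singleton, sdiff_self, bot_eq_empty]
    exact hκ0 (hle ∅)
  | insert a S ha ih =>
    intro Φ Ψ hΦ hΨ hle
    rw [antipodal_insert ha]
    have key : ∑ X ∈ S.powerset, κ (Φ X) (Ψ (S \ X)) +
        ∑ X ∈ S.powerset, κ (Φ (insert a X)) (Ψ (insert a (S \ X))) ≤
        ∑ X ∈ S.powerset, κ (Φ X) (Ψ (insert a (S \ X))) +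
          ∑ X ∈ S.powerset, κ (Φ (insert a X)) (Ψ (S \ X)) := by
      rw [← sum_add_distrib, ← sum_add_distrib]
      refine sum_le_sum fun X _ => ?_
      have h := hκ (hΦ (subset_insert a X)) (hΨ (subset_insert a (S \ X)))
      linarith
    have hΦ₁ : ∀ ⦃X Y : Finset α⦄, X ⊆ Y → Φ (insert a X) ≤ Φ (insert a Y) :=
      fun _ _ hXY => hΦ (insert_subset_insert a hXY)
    have hΨ₁ : ∀ ⦃X Y : Finset α⦄, X ⊆ Y → Ψ (insert a X) ≤ Ψ (insert a Y) :=
      fun _ _ hXY => hΨ (insert_subset_insert a hXY)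
    have ih₀ := ih Φ Ψ hΦ hΨ hle
    have ih₁ := ih (fun X => Φ (insert a X)) (fun X => Ψ (insert a X)) hΦ₁ hΨ₁ fun X => hle (insert a X)
    linarith

/-- Diagonal case `Φ = Ψ` of the kernel antipodal strong Harris inequality. -/
theorem antipodal_self_nonneg_of_submodular {κ : β → β → ℤ}
    (hκ : ∀ ⦃x y x' y' : β⦄, x ≤ y → x' ≤ y' → κ y y' + κ x x' ≤ κ x y' + κ y x')
    (hκ0 : ∀ ⦃x y : β⦄, x ≤ y → 0 ≤ κ x y) (S : Finset α) {Φ : Finset α → β}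
    (hΦ : ∀ ⦃X Y : Finset α⦄, X ⊆ Y → Φ X ≤ Φ Y) :
    0 ≤ ∑ X ∈ S.powerset, κ (Φ X) (Φ (S \ X)) :=
  antipodal_nonneg_of_submodular hκ hκ0 S Φ Φ hΦ hΦ fun _ => le_rfl

end StrongHarris

section RelativeStrongHarris

variable [Preorder β]

/-- **Kernel antipodal strong Harris inequality, relative version.**  The pointwise hypothesis `Φ X ≤ Ψ X` of
`antipodal_nonneg_of_submodular` may be replaced by ANY pointwise relation `R (Φ X) (Ψ X)`, provided the 2-decreasing kernel `κ`
is nonnegative on `R` (`R x y → 0 ≤ κ x y`): then `0 ≤ Σ_{X ⊆ S} κ(Φ X, Ψ(S ∖ X))` for all monotone `Φ, Ψ` with `R (Φ X) (Ψ X)` for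
every `X`.  (Same induction: the two same-level section pairs `(Φ,Ψ)|_S` and `(Φ(·∪{a}),Ψ(·∪{a}))` inherit the pointwise relation,
and the base case `S = ∅` is `κ(Φ ∅, Ψ ∅) ≥ 0`.)  Used with `R` = 'the two petal indices differ' this gives the cross-functional rows
for two sunflowers tied by a pointwise constraint (memo `prim-hp-7/FROM-prim-hp-7-g62-KSHARP-CONES.md` §1). -/
theorem antipodal_nonneg_of_submodular_rel {κ : β → β → ℤ}
    (hκ : ∀ ⦃x y x' y' : β⦄, x ≤ y → x' ≤ y' → κ y y' + κ x x' ≤ κ x y' + κ y x')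
    (R : β → β → Prop) (hκ0 : ∀ ⦃x y : β⦄, R x y → 0 ≤ κ x y) (S : Finset α) :
    ∀ Φ Ψ : Finset α → β, (∀ ⦃X Y : Finset α⦄, X ⊆ Y → Φ X ≤ Φ Y) → (∀ ⦃X Y : Finset α⦄, X ⊆ Y → Ψ X ≤ Ψ Y) →
      (∀ X, R (Φ X) (Ψ X)) → 0 ≤ ∑ X ∈ S.powerset, κ (Φ X) (Ψ (S \ X)) := by
  induction S using Finset.induction_on with
  | empty =>
    intro Φ Ψ _ _ hR
    simp only [powerset_empty, sum_singleton, sdiff_self, bot_eq_empty]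
    exact hκ0 (hR ∅)
  | insert a S ha ih =>
    intro Φ Ψ hΦ hΨ hR
    rw [antipodal_insert ha]
    have key : ∑ X ∈ S.powerset, κ (Φ X) (Ψ (S \ X)) +
        ∑ X ∈ S.powerset, κ (Φ (insert a X)) (Ψ (insert a (S \ X))) ≤
        ∑ X ∈ S.powerset, κ (Φ X) (Ψ (insert a (S \ X))) +
          ∑ X ∈ S.powerset, κ (Φ (insert a X)) (Ψ (S \ X)) := by
      rw [← sum_add_distrib, ← sum_add_distrib]
      refine sum_le_sum fun X _ => ?_
      have h := hκ (hΦ (subset_insert a X)) (hΨ (subset_insert a (S \ X)))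
      linarith
    have hΦ₁ : ∀ ⦃X Y : Finset α⦄, X ⊆ Y → Φ (insert a X) ≤ Φ (insert a Y) :=
      fun _ _ hXY => hΦ (insert_subset_insert a hXY)
    have hΨ₁ : ∀ ⦃X Y : Finset α⦄, X ⊆ Y → Ψ (insert a X) ≤ Ψ (insert a Y) :=
      fun _ _ hXY => hΨ (insert_subset_insert a hXY)
    have ih₀ := ih Φ Ψ hΦ hΨ hR
    have ih₁ := ih (fun X => Φ (insert a X)) (fun X => Ψ (insert a X)) hΦ₁ hΨ₁ fun X => hR (insert a X)
    linarith

end RelativeStrongHarris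

end KernelKleitman

end Summit.CriticalPhenomena.PercolationContinuityZ3.Theorems
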